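import Summits.Parity.BatemanHorn.Theorems.AlmostPrimeZerosDefs
import Summits.Parity.BatemanHorn.Theorems.SelbergDelangeRigidityLSDRealSegmentTypeISandwich
import Literature.NumberTheory.Sieve.BatemanHornProofs
import HarnessLib

/-!
# Route `AlmostPrimeZeros`, crux `SystemLSDRealSegment` (stmt-Parity-11292), line
# `beta-thinned-root-kernel`: the Type-I sandwich (`stub_typeISandwich`)

For a Bateman–Horn system `f = (f₁,…,f_k)`, real `y ≥ 1` and the Type-I sum
`T_x(y) = typeISum f y x = Σ_{0 ≤ n ≤ x} Σ_{d ∈ tuples f n, ∏ dᵢ ≤ x} ∏ᵢ h_y(dᵢ)` we prove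
`TypeISandwich k f y`:
`|T_x(y) − (x+1) Σ_{1 ≤ m ≤ x} b(m)| ≤ C (1 + Σ_{1 ≤ m ≤ x} m·b(m))` for all `x`, where
`b(m) = bCoeff f y m = Σ_{∏dᵢ = m} ∏ᵢ h_y(dᵢ)·δ_f(d)` and `δ_f(d) = tupleDens f d = c_f(d)/lcm(d)`.

Proof (Fubini over divisor tuples + complete residue systems).  Let `n₀` be such that every
`fᵢ(n) ≥ 1` for `n ≥ n₀` (`exists_forall_one_le_eval` of the sibling line `product-anatomy-subcritical`,
which we import for its periodic-count lemmas).  For such `n` a tuple `d` lies in `tuples f n` with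
`∏ dᵢ = m ∈ [1, x]` iff `d ∈ prodTuples k m` and `dᵢ ∣ fᵢ(n)` for all `i`
(`filter_tuples_filter_prod_eq`); the latter condition is `tupleLcm d`-periodic in `n`
(`periodic_tupleDvd`, from `Polynomial.sub_dvd_eval_sub`), so on the rows `n ∈ [n₀, x]` its count `N'_d`
satisfies `|N'_d − (x+1)·δ_f(d)| ≤ c_f(d) + n₀ δ_f(d) ≤ (1 + n₀)·m·δ_f(d)` because
`tupleLcm d ≤ ∏ dᵢ = m` (`abs_card_filter_Ico_sub_tupleDens_le`).  Swapping the sums gives the main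
term `(x+1) Σ_m b(m)` up to `(1+n₀) Σ_m m·b(m)` (`abs_mainRows_sub_le`); the rows `n < n₀` contribute between
`0` and the constant `Σ_{n<n₀} Σ_{d ∈ tuples f n} ∏ h_y(dᵢ)` since all weights are `≥ 0` for `y ≥ 1`.
No multiplicativity or evaluation of `b` is used (that is `stub_typeILocal`).

References: H. Halberstam, H.-E. Richert, *Sieve Methods* (1974), Lemma 5.4 and §5.3 (complete residue
systems); the line card `Cruxes/SystemLSDRealSegment/Lines/beta-thinned-root-kernel.md`.
-/

open Filter Finset Polynomial
open scoped BigOperators Topology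

namespace Summit.Parity.BatemanHorn.Cruxes.SystemLSDRealSegment.BetaThinnedRootKernel

open Literature.NumberTheory.Sieve
open Summit.Parity.BatemanHorn.Cruxes.LSDRealSegment.ProductAnatomySubcritical
  (abs_card_filter_Ico_sub_le exists_forall_one_le_eval)

noncomputable section

variable {k : ℕ}

/-! ### Non-negativity of the tuple weights for `y ≥ 1` -/

/-- For real `y ≥ 1` every tuple weight `∏ᵢ h_y(dᵢ)` is `≥ 0` (`h_y(p^v) ∈ {1, y − 1, y² − y, 0}`).
[folklore] -/
theorem prod_thinWeight_nonneg {y : ℝ} (hy : 1 ≤ y) (d : Fin k → ℕ) :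
    0 ≤ ∏ i, thinWeight y (d i) := by
  have hc : ∀ v : ℕ, 0 ≤ thinCoeff y v := fun v => by
    rcases Nat.lt_or_ge v 3 with h | h
    · interval_cases v
      · simp
      · simp only [thinCoeff_one]; linarith
      · simp only [thinCoeff_two]; nlinarith
    · rw [thinCoeff_of_three_le y h]
  refine Finset.prod_nonneg fun i _ => ?_
  unfold thinWeight Finsupp.prod
  exact Finset.prod_nonneg fun p _ => hc _

/-! ### The rows `n ≥ n₀`: tuples of level `≤ x` are positive tuples satisfying the congruences -/

/-- For a row `n` with all `fᵢ(n) ≥ 1` and `1 ≤ m ≤ x`: the tuples `d ∈ tuples f n` of level `∏ dᵢ ≤ x`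
with `∏ dᵢ = m` are exactly the `d ∈ prodTuples k m` with `dᵢ ∣ fᵢ(n)` for every `i`. [folklore] -/
theorem filter_tuples_filter_prod_eq {f : Fin k → ℤ[X]} {n : ℕ}
    (hn : ∀ i, (1 : ℤ) ≤ (f i).eval (n : ℤ)) {x m : ℕ} (hm : m ∈ Icc 1 x) :
    ((tuples f n).filter (fun d => ∏ i, d i ≤ x)).filter (fun d => ∏ i, d i = m) =
      (prodTuples k m).filter (fun d => ∀ i, ((d i : ℕ) : ℤ) ∣ (f i).eval (n : ℤ)) := by
  rw [Finset.mem_Icc] at hm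
  have hv0 : ∀ i, ((f i).eval (n : ℤ)).toNat ≠ 0 := fun i => by
    have := hn i
    omega
  have hv : ∀ i, ((((f i).eval (n : ℤ)).toNat : ℕ) : ℤ) = (f i).eval (n : ℤ) := fun i =>
    Int.toNat_of_nonneg (by linarith [hn i])
  have hdiv : ∀ i (e : ℕ), e ∈ divSet ((f i).eval (n : ℤ)).toNat ↔ ((e : ℕ) : ℤ) ∣ (f i).eval (n : ℤ) := by
    intro i e
    rw [divSet, max_eq_left (Nat.one_le_iff_ne_zero.mpr (hv0 i)), Nat.mem_divisors, ← hv i,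
      Int.natCast_dvd_natCast]
    exact ⟨fun h => h.1, fun h => ⟨h, hv0 i⟩⟩
  ext d
  simp only [Finset.mem_filter, tuples, prodTuples, Fintype.mem_piFinset, hdiv, Nat.mem_divisors]
  constructor
  · rintro ⟨⟨hd, -⟩, hprod⟩
    refine ⟨⟨fun i => ⟨?_, by omega⟩, hprod⟩, hd⟩
    rw [← hprod]
    exact Finset.dvd_prod_of_mem _ (Finset.mem_univ i)
  · rintro ⟨⟨-, hprod⟩, hd⟩
    exact ⟨⟨hd, by omega⟩, hprod⟩

/-- For a row `n` with all `fᵢ(n) ≥ 1`: the level-`x` tuple sum is the sum over `1 ≤ m ≤ x` and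
`d ∈ prodTuples k m` of the weight times the indicator of the tuple congruence at `n`. [folklore] -/
theorem sum_filter_tuples_eq {f : Fin k → ℤ[X]} {n : ℕ} (hn : ∀ i, (1 : ℤ) ≤ (f i).eval (n : ℤ))
    (y : ℝ) (x : ℕ) :
    ∑ d ∈ (tuples f n).filter (fun d => ∏ i, d i ≤ x), ∏ i, thinWeight y (d i) =
      ∑ m ∈ Icc 1 x, ∑ d ∈ prodTuples k m,
        if ∀ i, ((d i : ℕ) : ℤ) ∣ (f i).eval (n : ℤ) then ∏ i, thinWeight y (d i) else 0 := by
  rw [← Finset.sum_fiberwise_of_maps_to (s := (tuples f n).filter (fun d => ∏ i, d i ≤ x))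
    (t := Icc 1 x) (g := fun d => ∏ i, d i) ?_]
  · refine Finset.sum_congr rfl fun m hm => ?_
    rw [filter_tuples_filter_prod_eq hn hm, Finset.sum_filter]
  · intro d hd
    rw [Finset.mem_filter] at hd
    rw [Finset.mem_Icc]
    refine ⟨Nat.one_le_iff_ne_zero.mpr (Finset.prod_ne_zero_iff.mpr fun i _ => ?_), hd.2⟩
    have h : d i ∈ divSet ((f i).eval (n : ℤ)).toNat := Fintype.mem_piFinset.mp hd.1 i
    exact (Nat.pos_of_mem_divisors h).ne'

/-- Fubini on the rows `n ∈ [n₀, x]` (all values `≥ 1` there):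
`Σ_n Σ_{d, ∏dᵢ ≤ x} ∏h_y(dᵢ) = Σ_{1≤m≤x} Σ_{d ∈ prodTuples k m} ∏h_y(dᵢ) · N'_d`,
`N'_d = #{n ∈ [n₀, x] : dᵢ ∣ fᵢ(n) ∀ i}`. [folklore] -/
theorem sum_Ico_sum_filter_tuples_eq {f : Fin k → ℤ[X]} {n₀ : ℕ}
    (hn₀ : ∀ n, n₀ ≤ n → ∀ i, (1 : ℤ) ≤ (f i).eval (n : ℤ)) (y : ℝ) (x : ℕ) :
    ∑ n ∈ Ico n₀ (x + 1), ∑ d ∈ (tuples f n).filter (fun d => ∏ i, d i ≤ x), ∏ i, thinWeight y (d i) =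
      ∑ m ∈ Icc 1 x, ∑ d ∈ prodTuples k m, (∏ i, thinWeight y (d i)) *
        (#((Ico n₀ (x + 1)).filter fun n : ℕ => ∀ i, ((d i : ℕ) : ℤ) ∣ (f i).eval (n : ℤ)) : ℝ) := by
  rw [Finset.sum_congr rfl fun n hn => sum_filter_tuples_eq (hn₀ n (Finset.mem_Ico.mp hn).1) y x,
    Finset.sum_comm]
  refine Finset.sum_congr rfl fun m _ => ?_
  rw [Finset.sum_comm]
  refine Finset.sum_congr rfl fun d _ => ?_
  rw [← Finset.sum_filter, Finset.sum_const, nsmul_eq_mul, mul_comm]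

/-! ### The periodic count -/

/-- The tuple congruence `dᵢ ∣ fᵢ(n) ∀ i` is `tupleLcm d`-periodic in `n` (`dᵢ ∣ lcm d` and
`(a − b) ∣ fᵢ(a) − fᵢ(b)`). [folklore] -/
theorem periodic_tupleDvd (f : Fin k → ℤ[X]) (d : Fin k → ℕ) :
    Function.Periodic (fun n : ℕ => ∀ i, ((d i : ℕ) : ℤ) ∣ (f i).eval (n : ℤ)) (tupleLcm d) := by
  intro n
  simp only [eq_iff_iff]
  refine forall_congr' fun i => ?_
  have hdl : ((d i : ℕ) : ℤ) ∣ (tupleLcm d : ℤ) :=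
    Int.natCast_dvd_natCast.mpr (Finset.dvd_lcm (Finset.mem_univ i))
  have h : ((n + tupleLcm d : ℕ) : ℤ) - (n : ℤ) ∣
      (f i).eval ((n + tupleLcm d : ℕ) : ℤ) - (f i).eval (n : ℤ) :=
    Polynomial.sub_dvd_eval_sub _ _ _
  rw [show ((n + tupleLcm d : ℕ) : ℤ) - (n : ℤ) = (tupleLcm d : ℤ) by push_cast; ring] at h
  exact dvd_iff_dvd_of_dvd_sub (hdl.trans h)

/-- Complete residue systems: for `d ∈ prodTuples k m`, `m ≥ 1`, the count
`N'_d = #{n ∈ [n₀, x] : dᵢ ∣ fᵢ(n) ∀ i}` satisfies `|N'_d − (x+1)·δ_f(d)| ≤ (1 + n₀)·m·δ_f(d)`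
(full periods of length `tupleLcm d ≤ m` on `[n₀, x]`, `c_f(d) = tupleLcm d · δ_f(d) ≤ m·δ_f(d)`).
[folklore] -/
theorem abs_card_filter_Ico_sub_tupleDens_le (f : Fin k → ℤ[X]) (n₀ x : ℕ) {m : ℕ} {d : Fin k → ℕ}
    (hd : d ∈ prodTuples k m) (hm : 1 ≤ m) :
    |(#((Ico n₀ (x + 1)).filter fun n : ℕ => ∀ i, ((d i : ℕ) : ℤ) ∣ (f i).eval (n : ℤ)) : ℝ) -
        ((x : ℝ) + 1) * tupleDens f d| ≤ (1 + n₀) * m * tupleDens f d := by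
  have hprod : ∏ i, d i = m := (Finset.mem_filter.mp hd).2
  have hLm : tupleLcm d ∣ m := by
    rw [← hprod]
    exact Finset.lcm_dvd fun i _ => Finset.dvd_prod_of_mem _ (Finset.mem_univ i)
  have hm0 : m ≠ 0 := by omega
  have hL0 : tupleLcm d ≠ 0 := fun h => hm0 (by rw [h] at hLm; exact eq_zero_of_zero_dvd hLm)
  have hL1 : 0 < tupleLcm d := Nat.pos_of_ne_zero hL0
  have hLlem : (tupleLcm d : ℝ) ≤ m := by exact_mod_cast Nat.le_of_dvd (by omega) hLm
  have hLr : (0 : ℝ) < tupleLcm d := by exact_mod_cast hL1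
  have hm1 : (1 : ℝ) ≤ m := by exact_mod_cast hm
  set P : ℕ → Prop := fun n : ℕ => ∀ i, ((d i : ℕ) : ℤ) ∣ (f i).eval (n : ℤ) with hP
  set c : ℝ := (#((range (tupleLcm d)).filter P) : ℝ) with hc
  have hc0 : 0 ≤ c := Nat.cast_nonneg _
  have hdens : tupleDens f d = c / (tupleLcm d : ℝ) := rfl
  have hδ0 : 0 ≤ c / (tupleLcm d : ℝ) := div_nonneg hc0 hLr.le
  -- full periods on `[n₀, n₀ + ℓ)`, `ℓ = x + 1 - n₀`
  have hper := abs_card_filter_Ico_sub_le P hL1 (periodic_tupleDvd f d) n₀ (x + 1 - n₀)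
  have hIco : Ico n₀ (n₀ + (x + 1 - n₀)) = Ico n₀ (x + 1) := by
    rcases le_or_gt n₀ (x + 1) with h | h
    · rw [Nat.add_sub_cancel' h]
    · rw [Nat.sub_eq_zero_of_le h.le, add_zero, Finset.Ico_self, eq_comm, Finset.Ico_eq_empty_iff]
      omega
  rw [hIco] at hper
  -- `|ℓ - (x + 1)| ≤ n₀`
  have hℓ : |((x + 1 - n₀ : ℕ) : ℝ) - ((x : ℝ) + 1)| ≤ n₀ := by
    rcases le_or_gt n₀ (x + 1) with h | h
    · rw [Nat.cast_sub h]
      push_cast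
      rw [abs_le]
      constructor <;> linarith [(Nat.cast_nonneg n₀ : (0 : ℝ) ≤ n₀)]
    · rw [Nat.sub_eq_zero_of_le h.le]
      have hx : (x : ℝ) + 1 ≤ n₀ := by exact_mod_cast h.le
      rw [abs_le]
      constructor <;> push_cast <;> linarith [(Nat.cast_nonneg x : (0 : ℝ) ≤ x)]
  rw [hdens]
  set N : ℝ := (#((Ico n₀ (x + 1)).filter P) : ℝ) with hN
  set ℓ : ℝ := ((x + 1 - n₀ : ℕ) : ℝ) with hℓdef
  set L : ℝ := (tupleLcm d : ℝ) with hLdef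
  have hsplit : N - ((x : ℝ) + 1) * (c / L) = (N - ℓ * c / L) + (ℓ - ((x : ℝ) + 1)) * (c / L) := by ring
  have hcL : c ≤ m * (c / L) :=
    calc c = L * (c / L) := by field_simp
      _ ≤ m * (c / L) := mul_le_mul_of_nonneg_right hLlem hδ0
  calc |N - ((x : ℝ) + 1) * (c / L)|
      ≤ |N - ℓ * c / L| + |(ℓ - ((x : ℝ) + 1)) * (c / L)| := by rw [hsplit]; exact abs_add_le _ _
    _ ≤ c + n₀ * (c / L) := by
        rw [abs_mul, abs_of_nonneg hδ0]
        exact add_le_add hper (mul_le_mul_of_nonneg_right hℓ hδ0)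
    _ ≤ m * (c / L) + n₀ * (m * (c / L)) := by
        refine add_le_add hcL (mul_le_mul_of_nonneg_left ?_ (Nat.cast_nonneg _))
        exact le_mul_of_one_le_left hδ0 hm1
    _ = (1 + n₀) * m * (c / L) := by ring

/-! ### The main rows against the main term -/

/-- `|Σ_{1≤m≤x} Σ_{d ∈ prodTuples k m} ∏h_y(dᵢ)·N'_d − (x+1) Σ_{1≤m≤x} b(m)| ≤ (1 + n₀) Σ_{1≤m≤x} m·b(m)`
for `y ≥ 1` (weights `≥ 0`, `abs_card_filter_Ico_sub_tupleDens_le` tuple by tuple). [folklore] -/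
theorem abs_mainRows_sub_le (f : Fin k → ℤ[X]) {y : ℝ} (hy : 1 ≤ y) (n₀ x : ℕ) :
    |(∑ m ∈ Icc 1 x, ∑ d ∈ prodTuples k m, (∏ i, thinWeight y (d i)) *
        (#((Ico n₀ (x + 1)).filter fun n : ℕ => ∀ i, ((d i : ℕ) : ℤ) ∣ (f i).eval (n : ℤ)) : ℝ)) -
      ((x : ℝ) + 1) * ∑ m ∈ Icc 1 x, bCoeff f y m| ≤
      (1 + n₀) * ∑ m ∈ Icc 1 x, (m : ℝ) * bCoeff f y m := by
  rw [Finset.mul_sum, ← Finset.sum_sub_distrib, Finset.mul_sum]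
  refine (Finset.abs_sum_le_sum_abs _ _).trans (Finset.sum_le_sum fun m hm => ?_)
  have hm1 : 1 ≤ m := (Finset.mem_Icc.mp hm).1
  unfold bCoeff
  rw [Finset.mul_sum, ← Finset.sum_sub_distrib, Finset.mul_sum, Finset.mul_sum]
  refine (Finset.abs_sum_le_sum_abs _ _).trans (Finset.sum_le_sum fun d hd => ?_)
  have hW := prod_thinWeight_nonneg hy d
  rw [← mul_assoc, mul_comm ((x : ℝ) + 1), mul_assoc, ← mul_sub, abs_mul, abs_of_nonneg hW]
  calc (∏ i, thinWeight y (d i)) *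
        |(#((Ico n₀ (x + 1)).filter fun n : ℕ => ∀ i, ((d i : ℕ) : ℤ) ∣ (f i).eval (n : ℤ)) : ℝ) -
          ((x : ℝ) + 1) * tupleDens f d|
      ≤ (∏ i, thinWeight y (d i)) * ((1 + n₀) * m * tupleDens f d) :=
        mul_le_mul_of_nonneg_left (abs_card_filter_Ico_sub_tupleDens_le f n₀ x hd hm1) hW
    _ = (1 + n₀) * ((m : ℝ) * ((∏ i, thinWeight y (d i)) * tupleDens f d)) := by ring

/-! ### The registered stub -/

/-- **stub_typeISandwich** (registered stub of the checked skeleton, line `beta-thinned-root-kernel`):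
for a Bateman–Horn system `f` and real `y ≥ 1`, `TypeISandwich k f y`, i.e.
`|T_x(y) − (x+1) Σ_{1≤m≤x} b_{f,y}(m)| ≤ C (1 + Σ_{1≤m≤x} m·b_{f,y}(m))` for all `x`
(Fubini over divisor tuples, periodicity of the tuple congruence, complete residue systems on the rows
`n ≥ n₀` where all values are positive; the rows `n < n₀` are bounded by a constant since all weights are
`≥ 0`). [folklore] -/
theorem stub_typeISandwich : ∀ (k : ℕ) (f : Fin k → ℤ[X]), IsBatemanHornSystem f → ∀ y : ℝ, 1 ≤ y →
    TypeISandwich k f y := by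
  intro k f hf y hy
  obtain ⟨n₀, hn₀⟩ := exists_forall_one_le_eval hf
  have hW0 : ∀ d : Fin k → ℕ, 0 ≤ ∏ i, thinWeight y (d i) := prod_thinWeight_nonneg hy
  have hδ0 : ∀ d : Fin k → ℕ, 0 ≤ tupleDens f d := fun d =>
    div_nonneg (Nat.cast_nonneg _) (Nat.cast_nonneg _)
  -- the constant from the rows `n < n₀`
  set C₀ : ℝ := ∑ n ∈ range n₀, ∑ d ∈ tuples f n, ∏ i, thinWeight y (d i) with hC₀
  have hC₀0 : 0 ≤ C₀ := Finset.sum_nonneg fun n _ => Finset.sum_nonneg fun d _ => hW0 d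
  refine ⟨C₀ + (1 + n₀), fun x => ?_⟩
  set H : ℝ := ∑ m ∈ Icc 1 x, (m : ℝ) * bCoeff f y m with hH
  have hH0 : 0 ≤ H := Finset.sum_nonneg fun m _ => mul_nonneg (Nat.cast_nonneg _)
    (Finset.sum_nonneg fun d _ => mul_nonneg (hW0 d) (hδ0 d))
  -- split the rows at `n₀`
  have hT : typeISum f y x =
      (∑ n ∈ (range (x + 1)).filter (fun n => n < n₀),
        ∑ d ∈ (tuples f n).filter (fun d => ∏ i, d i ≤ x), ∏ i, thinWeight y (d i)) +
      ∑ n ∈ Ico n₀ (x + 1), ∑ d ∈ (tuples f n).filter (fun d => ∏ i, d i ≤ x), ∏ i, thinWeight y (d i) := by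
    unfold typeISum
    rw [← Finset.sum_filter_add_sum_filter_not (range (x + 1)) (fun n => n < n₀)]
    congr 1
    refine Finset.sum_congr ?_ fun _ _ => rfl
    ext n
    simp only [Finset.mem_filter, Finset.mem_range, Finset.mem_Ico]
    omega
  -- the rows `n < n₀`: between `0` and `C₀`
  have hT1 : 0 ≤ ∑ n ∈ (range (x + 1)).filter (fun n => n < n₀),
        ∑ d ∈ (tuples f n).filter (fun d => ∏ i, d i ≤ x), ∏ i, thinWeight y (d i) ∧
      ∑ n ∈ (range (x + 1)).filter (fun n => n < n₀),
        ∑ d ∈ (tuples f n).filter (fun d => ∏ i, d i ≤ x), ∏ i, thinWeight y (d i) ≤ C₀ := by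
    refine ⟨Finset.sum_nonneg fun n _ => Finset.sum_nonneg fun d _ => hW0 d, ?_⟩
    calc ∑ n ∈ (range (x + 1)).filter (fun n => n < n₀),
          ∑ d ∈ (tuples f n).filter (fun d => ∏ i, d i ≤ x), ∏ i, thinWeight y (d i)
        ≤ ∑ n ∈ range n₀, ∑ d ∈ (tuples f n).filter (fun d => ∏ i, d i ≤ x), ∏ i, thinWeight y (d i) := by
          refine Finset.sum_le_sum_of_subset_of_nonneg (fun n hn => ?_) fun n _ _ =>
            Finset.sum_nonneg fun d _ => hW0 d
          rw [Finset.mem_filter] at hn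
          exact Finset.mem_range.mpr hn.2
      _ ≤ C₀ := Finset.sum_le_sum fun n _ =>
          Finset.sum_le_sum_of_subset_of_nonneg (Finset.filter_subset _ _) fun d _ _ => hW0 d
  -- the rows `n ≥ n₀`: Fubini and complete residue systems
  have hmain := abs_mainRows_sub_le f hy n₀ x
  rw [← sum_Ico_sum_filter_tuples_eq hn₀ y x] at hmain
  rw [hT, add_sub_assoc]
  refine (abs_add_le _ _).trans ?_
  rw [abs_of_nonneg hT1.1]
  calc _ ≤ C₀ + (1 + n₀) * H := add_le_add hT1.2 hmain
    _ ≤ (C₀ + (1 + n₀)) * (1 + H) := by nlinarith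

end

end Summit.Parity.BatemanHorn.Cruxes.SystemLSDRealSegment.BetaThinnedRootKernel
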